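import Summits.BirchSwinnertonDyer.BirchSwinnertonDyer.Theorems.Rank2ObservatoryShiftWitness
import HarnessLib

/-!
# BirchSwinnertonDyer — rank ≥ 2 observatory: rank-2 kernel certificates, full `2`-torsion

HONEST FRAMING: per-curve certified theorems and census instruments; no claim on BSD in rank ≥ 2.

For the census rows with `E(ℚ)[2^∞] ≅ (ℤ/2)²` (three rational `2`-torsion points `T₁, T₂, T₃`, no
rational point of order `4`) the coset test of the independence criterion
`two_le_mordellWeilRank_of_cosetWitness` (`u = 1`) reads `R ∉ 2E(ℚ) + E(ℚ)[2]`, i.e.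
`R, R + T₁, R + T₂, R + T₃ ∉ 2E(ℚ)`, each certified at ITS OWN good prime
(`Rank2ObservatoryShiftWitness`). The torsion structure is certified once:
`E(ℚ)[2] ⊆ {O, T₁, T₂, T₃}`
at one good odd prime `ℓ₁` where the `T̃ᵢ` are the only affine `2`-torsion points
(`twoTorsionOnly3B`, injectivity of reduction on prime-to-`ℓ₁` torsion), and "no rational point of
order `4`" from one good prime per `Tᵢ` at which `T̃ᵢ` is no double — so `2m` kills `E(ℚ)_tors` when
`t = 2^e·m` does (`torsion_zsmul_eq_zero_of_noOrderFour`, generic descent). Results: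
`twoTorsionOnly3B` / `eq_zero_or_eq3_of_twoTorsionOnly3B`, `twoTorsion_eq_zero_or_eq3`,
`two_nsmul_eq_zero_of_fullTwoTorsionWitness`, `torsion_zsmul_eq_zero_of_noOrderFour`, the tools
`add_eq_of_zmodChord_twoTorsion` (`T₁ + T₂ = T₃` from one chord mod `ℓ₁`) and
`two_nsmul_ne_add_of_shiftFree` (used by the `ℤ/2 × ℤ/4` certificates), and the certificate
`two_le_mordellWeilRank_of_kernelCertT22`. Sorry-free.
References: Silverman AEC (2009) III.2.3, VII.3.1(b), VII.3.4, VIII.6.7; Cremona (1997) §3.3, §3.5.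
-/

-- single-conjunct summit: `Summit.BirchSwinnertonDyer.BirchSwinnertonDyer.…` repeats the name by design
set_option linter.dupNamespace false

namespace Summit.BirchSwinnertonDyer.BirchSwinnertonDyer.Rank2Observatory

open WeierstrassCurve Literature.NumberTheory.EllipticCurves

/-! ### Torsion structure from three rational `2`-torsion points -/

section FullTwoTorsion

variable (V : WeierstrassCurve ℤ)

/-- Boolean: every affine point `(β, γ)` of `Ẽ(𝔽_q)` with `2γ + a₁β + a₃ = 0` is the reduction of
one of the three given integral points. [cite: SilvermanAEC2009, III.2.3] -/
def twoTorsionOnly3B (V : WeierstrassCurve ℤ) (q : ℕ) [NeZero q] (x₁ y₁ x₂ y₂ x₃ y₃ : ℤ) : Bool :=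
  decide (∀ β γ : ZMod q,
    γ ^ 2 + (V.a₁ : ZMod q) * β * γ + (V.a₃ : ZMod q) * γ =
      β ^ 3 + (V.a₂ : ZMod q) * β ^ 2 + (V.a₄ : ZMod q) * β + (V.a₆ : ZMod q) →
    2 * γ + (V.a₁ : ZMod q) * β + (V.a₃ : ZMod q) = 0 →
      (β = (x₁ : ZMod q) ∧ γ = (y₁ : ZMod q)) ∨ (β = (x₂ : ZMod q) ∧ γ = (y₂ : ZMod q)) ∨
        (β = (x₃ : ZMod q) ∧ γ = (y₃ : ZMod q)))

/-- Soundness of `twoTorsionOnly3B` in `Ẽ(𝔽_q)`: a point `z` with `2 • z = 0` is `O` or the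
reduction of one of the three given points. [cite: SilvermanAEC2009, III.2.3] -/
theorem eq_zero_or_eq3_of_twoTorsionOnly3B (q : ℕ) [Fact q.Prime] {x₁ y₁ x₂ y₂ x₃ y₃ : ℤ}
    (h1 : twoTorsionOnly3B V q x₁ y₁ x₂ y₂ x₃ y₃ = true)
    (z : (V.map (Int.castRingHom (ZMod q))).toAffine.Point) (hz : 2 • z = 0) :
    z = 0 ∨ (∃ hns, z = Affine.Point.some (x₁ : ZMod q) (y₁ : ZMod q) hns) ∨
      (∃ hns, z = Affine.Point.some (x₂ : ZMod q) (y₂ : ZMod q) hns) ∨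
      (∃ hns, z = Affine.Point.some (x₃ : ZMod q) (y₃ : ZMod q) hns) := by
  classical
  simp only [twoTorsionOnly3B, decide_eq_true_eq] at h1
  rcases z with _ | ⟨β, γ, hns⟩
  · exact Or.inl rfl
  · right
    have ha₁ : (V.map (Int.castRingHom (ZMod q))).a₁ = (V.a₁ : ZMod q) := by
      simp [WeierstrassCurve.map]
    have ha₂ : (V.map (Int.castRingHom (ZMod q))).a₂ = (V.a₂ : ZMod q) := by
      simp [WeierstrassCurve.map]
    have ha₃ : (V.map (Int.castRingHom (ZMod q))).a₃ = (V.a₃ : ZMod q) := by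
      simp [WeierstrassCurve.map]
    have ha₄ : (V.map (Int.castRingHom (ZMod q))).a₄ = (V.a₄ : ZMod q) := by
      simp [WeierstrassCurve.map]
    have ha₆ : (V.map (Int.castRingHom (ZMod q))).a₆ = (V.a₆ : ZMod q) := by
      simp [WeierstrassCurve.map]
    have heq : γ ^ 2 + (V.a₁ : ZMod q) * β * γ + (V.a₃ : ZMod q) * γ =
        β ^ 3 + (V.a₂ : ZMod q) * β ^ 2 + (V.a₄ : ZMod q) * β + (V.a₆ : ZMod q) := by
      have e := (Affine.equation_iff β γ).mp hns.left
      rwa [ha₁, ha₂, ha₃, ha₄, ha₆] at e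
    rw [two_nsmul] at hz
    have hneg : Affine.Point.some β γ hns = -Affine.Point.some β γ hns :=
      eq_neg_of_add_eq_zero_left hz
    rw [Affine.Point.neg_some, Affine.Point.some.injEq] at hneg
    have h2t : 2 * γ + (V.a₁ : ZMod q) * β + (V.a₃ : ZMod q) = 0 := by
      have hγ := hneg.2
      rw [Affine.negY, ha₁, ha₃] at hγ
      linear_combination hγ
    rcases h1 β γ heq h2t with ⟨hβ, hγ⟩ | ⟨hβ, hγ⟩ | ⟨hβ, hγ⟩
    · left; subst hβ; subst hγ; exact ⟨hns, rfl⟩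
    · right; left; subst hβ; subst hγ; exact ⟨hns, rfl⟩
    · right; right; subst hβ; subst hγ; exact ⟨hns, rfl⟩

open scoped Classical in
/-- **`E(ℚ)[2] ⊆ {O, T₁, T₂, T₃}`** from three integral `2`-torsion points and a good odd prime `ℓ₁`
at which their reductions are the only affine `2`-torsion points (`twoTorsionOnly3B`).
[cite: SilvermanAEC2009, Prop. VII.3.1(b)] -/
theorem twoTorsion_eq_zero_or_eq3 {x₁ y₁ x₂ y₂ x₃ y₃ : ℤ}
    (hT₁ : y₁ ^ 2 + V.a₁ * x₁ * y₁ + V.a₃ * y₁ = x₁ ^ 3 + V.a₂ * x₁ ^ 2 + V.a₄ * x₁ + V.a₆)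
    (hT₁2 : 2 * y₁ + V.a₁ * x₁ + V.a₃ = 0)
    (hT₂ : y₂ ^ 2 + V.a₁ * x₂ * y₂ + V.a₃ * y₂ = x₂ ^ 3 + V.a₂ * x₂ ^ 2 + V.a₄ * x₂ + V.a₆)
    (hT₂2 : 2 * y₂ + V.a₁ * x₂ + V.a₃ = 0)
    (hT₃ : y₃ ^ 2 + V.a₁ * x₃ * y₃ + V.a₃ * y₃ = x₃ ^ 3 + V.a₂ * x₃ ^ 2 + V.a₄ * x₃ + V.a₆)
    (hT₃2 : 2 * y₃ + V.a₁ * x₃ + V.a₃ = 0)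
    (ℓ₁ : ℕ) [Fact ℓ₁.Prime] (hℓ₁ : ¬ (ℓ₁ : ℤ) ∣ V.Δ) (hodd : ℓ₁ ≠ 2)
    (hB : twoTorsionOnly3B V ℓ₁ x₁ y₁ x₂ y₂ x₃ y₃ = true)
    (τ : (V.map (Int.castRingHom ℚ)).toAffine.Point) (hτ : (2 : ℤ) • τ = 0) :
    τ = 0 ∨ τ = Affine.Point.some (x₁ : ℚ) (y₁ : ℚ)
        (nonsingular_rat_of_eq V (Δ_ne_zero_of_not_dvd V hℓ₁) hT₁) ∨
      τ = Affine.Point.some (x₂ : ℚ) (y₂ : ℚ)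
        (nonsingular_rat_of_eq V (Δ_ne_zero_of_not_dvd V hℓ₁) hT₂) ∨
      τ = Affine.Point.some (x₃ : ℚ) (y₃ : ℚ)
        (nonsingular_rat_of_eq V (Δ_ne_zero_of_not_dvd V hℓ₁) hT₃) := by
  have hΔ : V.Δ ≠ 0 := Δ_ne_zero_of_not_dvd V hℓ₁
  haveI := isElliptic_rat V hΔ
  have hn : ¬ ℓ₁ ∣ 2 := fun hd =>
    hodd ((Nat.prime_dvd_prime_iff_eq (Fact.out : ℓ₁.Prime) Nat.prime_two).mp hd)
  have hτ2 : 2 • τ = 0 := by rw [← natCast_zsmul]; exact_mod_cast hτ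
  have hred : 2 • reduceMod V ℓ₁ hℓ₁ τ = 0 := by rw [← map_nsmul, hτ2, map_zero]
  rcases eq_zero_or_eq3_of_twoTorsionOnly3B V ℓ₁ hB _ hred with
    h0 | ⟨hns, hsome⟩ | ⟨hns, hsome⟩ | ⟨hns, hsome⟩
  · exact Or.inl (eq_zero_of_reduceMod_eq_zero V ℓ₁ hℓ₁ τ hn hτ2 h0)
  · exact Or.inr (Or.inl (eq_of_reduceMod_eq_twoTorsion V ℓ₁ hℓ₁ hodd hT₁ hT₁2 τ hτ2 hsome))
  · exact Or.inr (Or.inr (Or.inl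
      (eq_of_reduceMod_eq_twoTorsion V ℓ₁ hℓ₁ hodd hT₂ hT₂2 τ hτ2 hsome)))
  · exact Or.inr (Or.inr (Or.inr
      (eq_of_reduceMod_eq_twoTorsion V ℓ₁ hℓ₁ hodd hT₃ hT₃2 τ hτ2 hsome)))

open scoped Classical in
/-- **No rational point of order `4`** given the full rational `2`-torsion `{O, T₁, T₂, T₃}`
(`twoTorsionOnly3B` at a good odd `ℓ₁`) and, for each `i`, a good prime `lᵢ` at which `T̃ᵢ` is no
double: `4 • w = 0 → 2 • w = 0`. [cite: SilvermanAEC2009, Prop. VII.3.1(b)] -/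
theorem two_nsmul_eq_zero_of_fullTwoTorsionWitness {x₁ y₁ x₂ y₂ x₃ y₃ : ℤ}
    (hT₁ : y₁ ^ 2 + V.a₁ * x₁ * y₁ + V.a₃ * y₁ = x₁ ^ 3 + V.a₂ * x₁ ^ 2 + V.a₄ * x₁ + V.a₆)
    (hT₁2 : 2 * y₁ + V.a₁ * x₁ + V.a₃ = 0)
    (hT₂ : y₂ ^ 2 + V.a₁ * x₂ * y₂ + V.a₃ * y₂ = x₂ ^ 3 + V.a₂ * x₂ ^ 2 + V.a₄ * x₂ + V.a₆)
    (hT₂2 : 2 * y₂ + V.a₁ * x₂ + V.a₃ = 0)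
    (hT₃ : y₃ ^ 2 + V.a₁ * x₃ * y₃ + V.a₃ * y₃ = x₃ ^ 3 + V.a₂ * x₃ ^ 2 + V.a₄ * x₃ + V.a₆)
    (hT₃2 : 2 * y₃ + V.a₁ * x₃ + V.a₃ = 0)
    (ℓ₁ : ℕ) [Fact ℓ₁.Prime] (hℓ₁ : ¬ (ℓ₁ : ℤ) ∣ V.Δ) (hodd : ℓ₁ ≠ 2)
    (hB : twoTorsionOnly3B V ℓ₁ x₁ y₁ x₂ y₂ x₃ y₃ = true)
    (l₁ l₂ l₃ : ℕ) [Fact l₁.Prime] [Fact l₂.Prime] [Fact l₃.Prime]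
    (hl₁ : ¬ (l₁ : ℤ) ∣ V.Δ) (hl₂ : ¬ (l₂ : ℤ) ∣ V.Δ) (hl₃ : ¬ (l₃ : ℤ) ∣ V.Δ)
    (hD₁ : xDoubleFree V l₁ (x₁ : ZMod l₁) = true) (hD₂ : xDoubleFree V l₂ (x₂ : ZMod l₂) = true)
    (hD₃ : xDoubleFree V l₃ (x₃ : ZMod l₃) = true)
    (w : (V.map (Int.castRingHom ℚ)).toAffine.Point) (h : 4 • w = 0) : 2 • w = 0 := by
  have hΔ : V.Δ ≠ 0 := Δ_ne_zero_of_not_dvd V hℓ₁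
  haveI := isElliptic_rat V hΔ
  have h4w : (2 : ℤ) • (2 • w) = 0 := by
    rw [show (2 : ℤ) = ((2 : ℕ) : ℤ) from rfl, natCast_zsmul, ← mul_nsmul]; exact h
  rcases twoTorsion_eq_zero_or_eq3 V hT₁ hT₁2 hT₂ hT₂2 hT₃ hT₃2 ℓ₁ hℓ₁ hodd hB (2 • w) h4w with
    h0 | h | h | h
  · exact h0
  · exact absurd h (two_nsmul_ne_some_of_xDoubleFree V hΔ hT₁ l₁ hl₁ hD₁ w)
  · exact absurd h (two_nsmul_ne_some_of_xDoubleFree V hΔ hT₂ l₂ hl₂ hD₂ w)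
  · exact absurd h (two_nsmul_ne_some_of_xDoubleFree V hΔ hT₃ l₃ hl₃ hD₃ w)

/-- **`2m` kills `E(ℚ)_tors`** when `t = 2^e·m` does (`annihilatorCheck`) and `E(ℚ)` has no point of
order `4` (hypothesis `h42`, e.g. `two_nsmul_eq_zero_of_fullTwoTorsionWitness`).
[cite: SilvermanAEC2009, Prop. VII.3.1(b), Thm. VII.3.4] -/
theorem torsion_zsmul_eq_zero_of_noOrderFour {S : List (ℕ × ℕ)} {t e m : ℕ} (hte : t = 2 ^ e * m)
    (hS : ∀ ℓN ∈ S, ℓN.1.Prime ∧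
      ∀ (x : (V.map (Int.castRingHom ℚ)).toAffine.Point) (n : ℕ), ¬ ℓN.1 ∣ n → n • x = 0 →
        ℓN.2 • x = 0)
    (ht : annihilatorCheck S t = true)
    (h42 : ∀ w : (V.map (Int.castRingHom ℚ)).toAffine.Point, 4 • w = 0 → 2 • w = 0)
    (x : (V.map (Int.castRingHom ℚ)).toAffine.Point) (hx : IsOfFinAddOrder x) :
    ((2 : ℤ) ^ 1 * (m : ℤ)) • x = 0 := by
  have htx : t • x = 0 := nsmul_eq_zero_of_annihilatorCheck hS ht hx
  rw [hte, mul_nsmul'] at htx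
  rw [pow_one, ← Nat.cast_ofNat, ← Nat.cast_mul, natCast_zsmul, mul_nsmul']
  cases e with
  | zero => rw [pow_zero, one_nsmul] at htx; rw [htx, nsmul_zero]
  | succ k => exact two_nsmul_eq_zero_of_pow_nsmul_eq_zero h42 k _ htx

open scoped Classical in
/-- **`T₁ + T₂ = T₃`** for integral `2`-torsion points from a chord certificate mod ONE good odd
prime (the difference is `2`-torsion with trivial reduction).
[cite: SilvermanAEC2009, Prop. VII.3.1(b)] -/
theorem add_eq_of_zmodChord_twoTorsion (ℓ : ℕ) [Fact ℓ.Prime] (hℓ : ¬ (ℓ : ℤ) ∣ V.Δ) (hodd : ℓ ≠ 2)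
    {x₁ y₁ x₂ y₂ x₃ y₃ : ℤ}
    (h₁ : y₁ ^ 2 + V.a₁ * x₁ * y₁ + V.a₃ * y₁ = x₁ ^ 3 + V.a₂ * x₁ ^ 2 + V.a₄ * x₁ + V.a₆)
    (h₁2 : 2 * y₁ + V.a₁ * x₁ + V.a₃ = 0)
    (h₂ : y₂ ^ 2 + V.a₁ * x₂ * y₂ + V.a₃ * y₂ = x₂ ^ 3 + V.a₂ * x₂ ^ 2 + V.a₄ * x₂ + V.a₆)
    (h₂2 : 2 * y₂ + V.a₁ * x₂ + V.a₃ = 0)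
    (h₃ : y₃ ^ 2 + V.a₁ * x₃ * y₃ + V.a₃ * y₃ = x₃ ^ 3 + V.a₂ * x₃ ^ 2 + V.a₄ * x₃ + V.a₆)
    (h₃2 : 2 * y₃ + V.a₁ * x₃ + V.a₃ = 0)
    (hc : zmodChord V ℓ (x₁ : ZMod ℓ) (y₁ : ZMod ℓ) (x₂ : ZMod ℓ) (y₂ : ZMod ℓ) (x₃ : ZMod ℓ)
      (y₃ : ZMod ℓ) = true) :
    (Affine.Point.some (x₁ : ℚ) (y₁ : ℚ) (nonsingular_rat_of_eq V (Δ_ne_zero_of_not_dvd V hℓ) h₁) +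
        Affine.Point.some (x₂ : ℚ) (y₂ : ℚ)
          (nonsingular_rat_of_eq V (Δ_ne_zero_of_not_dvd V hℓ) h₂) :
        (V.map (Int.castRingHom ℚ)).toAffine.Point) =
      Affine.Point.some (x₃ : ℚ) (y₃ : ℚ)
        (nonsingular_rat_of_eq V (Δ_ne_zero_of_not_dvd V hℓ) h₃) := by
  have hΔ : V.Δ ≠ 0 := Δ_ne_zero_of_not_dvd V hℓ
  haveI := isElliptic_rat V hΔ
  have hn : ¬ ℓ ∣ 2 := fun hd =>
    hodd ((Nat.prime_dvd_prime_iff_eq (Fact.out : ℓ.Prime) Nat.prime_two).mp hd)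
  have e₁ : V.toAffine.Equation x₁ y₁ := (Affine.equation_iff x₁ y₁).mpr h₁
  have e₂ : V.toAffine.Equation x₂ y₂ := (Affine.equation_iff x₂ y₂).mpr h₂
  have e₃ : V.toAffine.Equation x₃ y₃ := (Affine.equation_iff x₃ y₃).mpr h₃
  set T₁ : (V.map (Int.castRingHom ℚ)).toAffine.Point :=
    .some (x₁ : ℚ) (y₁ : ℚ) (nonsingular_rat_of_eq V hΔ h₁) with hT₁def
  set T₂ : (V.map (Int.castRingHom ℚ)).toAffine.Point :=
    .some (x₂ : ℚ) (y₂ : ℚ) (nonsingular_rat_of_eq V hΔ h₂) with hT₂def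
  set T₃ : (V.map (Int.castRingHom ℚ)).toAffine.Point :=
    .some (x₃ : ℚ) (y₃ : ℚ) (nonsingular_rat_of_eq V hΔ h₃) with hT₃def
  have h2T₁ : 2 • T₁ = 0 := two_nsmul_some_eq_zero V hΔ h₁ h₁2
  have h2T₂ : 2 • T₂ = 0 := two_nsmul_some_eq_zero V hΔ h₂ h₂2
  have h2T₃ : 2 • T₃ = 0 := two_nsmul_some_eq_zero V hΔ h₃ h₃2
  obtain ⟨hns₃, e⟩ := exists_some_add_some_of_zmodChord V ℓ
    (nonsingular_zmod_of_equation V ℓ hℓ e₁) (nonsingular_zmod_of_equation V ℓ hℓ e₂) hc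
  have hred0 : reduceMod V ℓ hℓ (T₁ + T₂ - T₃) = 0 := by
    rw [map_sub, map_add, hT₁def, hT₂def, hT₃def, reduceMod_some V ℓ hℓ e₁,
      reduceMod_some V ℓ hℓ e₂, reduceMod_some V ℓ hℓ e₃, e, sub_self]
  have h2 : 2 • (T₁ + T₂ - T₃) = 0 := by
    rw [nsmul_sub, nsmul_add, h2T₁, h2T₂, h2T₃, add_zero, sub_zero]
  exact sub_eq_zero.mp (eq_zero_of_reduceMod_eq_zero V ℓ hℓ _ hn h2 hred0)

open scoped Classical in
/-- `2 • w ≠ R + T` for integral `R = (X, Y)`, `T = (x_T, y_T)` whose sum mod a good prime (chord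
certificate) is no double (`shiftFree`). [cite: SilvermanAEC2009, Prop. VII.3.1(b)] -/
theorem two_nsmul_ne_add_of_shiftFree (hΔ : V.Δ ≠ 0) (q : ℕ) [Fact q.Prime] (hq : ¬ (q : ℤ) ∣ V.Δ)
    {X Y xT yT A B : ℤ}
    (hX : Y ^ 2 + V.a₁ * X * Y + V.a₃ * Y = X ^ 3 + V.a₂ * X ^ 2 + V.a₄ * X + V.a₆)
    (hT : yT ^ 2 + V.a₁ * xT * yT + V.a₃ * yT = xT ^ 3 + V.a₂ * xT ^ 2 + V.a₄ * xT + V.a₆)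
    (hw : shiftFree V q X Y xT yT A B = true) (w : (V.map (Int.castRingHom ℚ)).toAffine.Point) :
    2 • w ≠ Affine.Point.some (X : ℚ) (Y : ℚ) (nonsingular_rat_of_eq V hΔ hX) +
      Affine.Point.some (xT : ℚ) (yT : ℚ) (nonsingular_rat_of_eq V hΔ hT) := by
  haveI := isElliptic_rat V hΔ
  intro hwT
  simp only [shiftFree, Bool.and_eq_true] at hw
  obtain ⟨hc, hfree⟩ := hw
  have e : V.toAffine.Equation X Y := (Affine.equation_iff X Y).mpr hX
  have eT : V.toAffine.Equation xT yT := (Affine.equation_iff xT yT).mpr hT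
  obtain ⟨h₃, e₃⟩ := exists_some_add_some_of_zmodChord V q
    (nonsingular_zmod_of_equation V q hq e) (nonsingular_zmod_of_equation V q hq eT) hc
  have hmem : (Affine.Point.some (A : ZMod q) (B : ZMod q) h₃ :
      (V.map (Int.castRingHom (ZMod q))).toAffine.Point)
        ∈ twoCoset (V.map (Int.castRingHom (ZMod q))).toAffine.Point 0 := by
    refine ⟨reduceMod V q hq w, 0, by simp, ?_⟩
    rw [two_zsmul, add_zero, ← two_nsmul, ← map_nsmul, hwT, map_add, reduceMod_some V q hq e,
      reduceMod_some V q hq eT, e₃]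
  exact not_mem_twoCoset_of_xDoubleFree V q hfree _ hmem

end FullTwoTorsion

/-! ### The rank-2 certificate for `E(ℚ)[2^∞] ≅ (ℤ/2)²` -/

section Assembly

variable (V : WeierstrassCurve ℤ)

/-- **Rank-2 kernel certificate for full rational `2`-torsion** (`E(ℚ)[2^∞] ≅ (ℤ/2)²`): integral
points `P₁, P₂`; torsion annihilator `t = 2^e·m` from kernel point counts; the three rational
`2`-torsion points `Tᵢ = (xᵢ, yᵢ)` (integral, `2yᵢ + a₁xᵢ + a₃ = 0`), a good odd prime `ℓ₁` with
`twoTorsionOnly3B` (`E(ℚ)[2] = {O, T₁, T₂, T₃}`) and good primes `lᵢ` at which `T̃ᵢ` is no double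
(no rational `4`-torsion, so `2m` kills `E(ℚ)_tors`, `u = 1`); and for each `R ∈ {P₁, P₂, P₁ + P₂}`
FOUR good primes certifying `R, R + T₁, R + T₂, R + T₃ ∉ 2E(ℚ)` one at a time (`xDoubleFree` /
`shiftFree` / `sumFree` / `sumShiftFree`, sums by chord certificates mod the prime). Then
`2 ≤ rank_ℤ E(ℚ)`. [cite: CremonaAlgorithms1997, §3.5] [cite: SilvermanAEC2009, Thm. VIII.6.7] -/
theorem two_le_mordellWeilRank_of_kernelCertT22 {X₁ Y₁ X₂ Y₂ : ℤ}
    (h₁ : Y₁ ^ 2 + V.a₁ * X₁ * Y₁ + V.a₃ * Y₁ = X₁ ^ 3 + V.a₂ * X₁ ^ 2 + V.a₄ * X₁ + V.a₆)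
    (h₂ : Y₂ ^ 2 + V.a₁ * X₂ * Y₂ + V.a₃ * Y₂ = X₂ ^ 3 + V.a₂ * X₂ ^ 2 + V.a₄ * X₂ + V.a₆)
    {S : List (ℕ × ℕ)} {t e m : ℕ} (hm : m % 2 = 1) (hte : t = 2 ^ e * m)
    (hS : ∀ ℓN ∈ S, ℓN.1.Prime ∧
      ∀ (x : (V.map (Int.castRingHom ℚ)).toAffine.Point) (n : ℕ), ¬ ℓN.1 ∣ n → n • x = 0 →
        ℓN.2 • x = 0)
    (ht : annihilatorCheck S t = true)
    {x₁ y₁ x₂ y₂ x₃ y₃ : ℤ}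
    (hT₁ : y₁ ^ 2 + V.a₁ * x₁ * y₁ + V.a₃ * y₁ = x₁ ^ 3 + V.a₂ * x₁ ^ 2 + V.a₄ * x₁ + V.a₆)
    (hT₁2 : 2 * y₁ + V.a₁ * x₁ + V.a₃ = 0)
    (hT₂ : y₂ ^ 2 + V.a₁ * x₂ * y₂ + V.a₃ * y₂ = x₂ ^ 3 + V.a₂ * x₂ ^ 2 + V.a₄ * x₂ + V.a₆)
    (hT₂2 : 2 * y₂ + V.a₁ * x₂ + V.a₃ = 0)
    (hT₃ : y₃ ^ 2 + V.a₁ * x₃ * y₃ + V.a₃ * y₃ = x₃ ^ 3 + V.a₂ * x₃ ^ 2 + V.a₄ * x₃ + V.a₆)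
    (hT₃2 : 2 * y₃ + V.a₁ * x₃ + V.a₃ = 0)
    (ℓ₁ : ℕ) [Fact ℓ₁.Prime] (hℓ₁ : ¬ (ℓ₁ : ℤ) ∣ V.Δ) (hodd : ℓ₁ ≠ 2)
    (hB : twoTorsionOnly3B V ℓ₁ x₁ y₁ x₂ y₂ x₃ y₃ = true)
    (l₁ l₂ l₃ : ℕ) [Fact l₁.Prime] [Fact l₂.Prime] [Fact l₃.Prime]
    (hl₁ : ¬ (l₁ : ℤ) ∣ V.Δ) (hl₂ : ¬ (l₂ : ℤ) ∣ V.Δ) (hl₃ : ¬ (l₃ : ℤ) ∣ V.Δ)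
    (hD₁ : xDoubleFree V l₁ (x₁ : ZMod l₁) = true) (hD₂ : xDoubleFree V l₂ (x₂ : ZMod l₂) = true)
    (hD₃ : xDoubleFree V l₃ (x₃ : ZMod l₃) = true)
    (q₁₀ q₁₁ q₁₂ q₁₃ : ℕ) [Fact q₁₀.Prime] [Fact q₁₁.Prime] [Fact q₁₂.Prime] [Fact q₁₃.Prime]
    (hq₁₀ : ¬ (q₁₀ : ℤ) ∣ V.Δ) (hq₁₁ : ¬ (q₁₁ : ℤ) ∣ V.Δ) (hq₁₂ : ¬ (q₁₂ : ℤ) ∣ V.Δ)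
    (hq₁₃ : ¬ (q₁₃ : ℤ) ∣ V.Δ)
    (hw₁₀ : xDoubleFree V q₁₀ (X₁ : ZMod q₁₀) = true)
    {A₁₁ B₁₁ : ℤ} (hw₁₁ : shiftFree V q₁₁ X₁ Y₁ x₁ y₁ A₁₁ B₁₁ = true)
    {A₁₂ B₁₂ : ℤ} (hw₁₂ : shiftFree V q₁₂ X₁ Y₁ x₂ y₂ A₁₂ B₁₂ = true)
    {A₁₃ B₁₃ : ℤ} (hw₁₃ : shiftFree V q₁₃ X₁ Y₁ x₃ y₃ A₁₃ B₁₃ = true)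
    (q₂₀ q₂₁ q₂₂ q₂₃ : ℕ) [Fact q₂₀.Prime] [Fact q₂₁.Prime] [Fact q₂₂.Prime] [Fact q₂₃.Prime]
    (hq₂₀ : ¬ (q₂₀ : ℤ) ∣ V.Δ) (hq₂₁ : ¬ (q₂₁ : ℤ) ∣ V.Δ) (hq₂₂ : ¬ (q₂₂ : ℤ) ∣ V.Δ)
    (hq₂₃ : ¬ (q₂₃ : ℤ) ∣ V.Δ)
    (hw₂₀ : xDoubleFree V q₂₀ (X₂ : ZMod q₂₀) = true)
    {A₂₁ B₂₁ : ℤ} (hw₂₁ : shiftFree V q₂₁ X₂ Y₂ x₁ y₁ A₂₁ B₂₁ = true)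
    {A₂₂ B₂₂ : ℤ} (hw₂₂ : shiftFree V q₂₂ X₂ Y₂ x₂ y₂ A₂₂ B₂₂ = true)
    {A₂₃ B₂₃ : ℤ} (hw₂₃ : shiftFree V q₂₃ X₂ Y₂ x₃ y₃ A₂₃ B₂₃ = true)
    (q₃₀ q₃₁ q₃₂ q₃₃ : ℕ) [Fact q₃₀.Prime] [Fact q₃₁.Prime] [Fact q₃₂.Prime] [Fact q₃₃.Prime]
    (hq₃₀ : ¬ (q₃₀ : ℤ) ∣ V.Δ) (hq₃₁ : ¬ (q₃₁ : ℤ) ∣ V.Δ) (hq₃₂ : ¬ (q₃₂ : ℤ) ∣ V.Δ)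
    (hq₃₃ : ¬ (q₃₃ : ℤ) ∣ V.Δ)
    {X₃₀ Y₃₀ : ℤ} (hw₃₀ : sumFree V q₃₀ X₁ Y₁ X₂ Y₂ X₃₀ Y₃₀ = true)
    {X₃₁ Y₃₁ A₃₁ B₃₁ : ℤ} (hw₃₁ : sumShiftFree V q₃₁ X₁ Y₁ X₂ Y₂ X₃₁ Y₃₁ x₁ y₁ A₃₁ B₃₁ = true)
    {X₃₂ Y₃₂ A₃₂ B₃₂ : ℤ} (hw₃₂ : sumShiftFree V q₃₂ X₁ Y₁ X₂ Y₂ X₃₂ Y₃₂ x₂ y₂ A₃₂ B₃₂ = true)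
    {X₃₃ Y₃₃ A₃₃ B₃₃ : ℤ} (hw₃₃ : sumShiftFree V q₃₃ X₁ Y₁ X₂ Y₂ X₃₃ Y₃₃ x₃ y₃ A₃₃ B₃₃ = true) :
    2 ≤ (V.map (Int.castRingHom ℚ)).mordellWeilRank := by
  classical
  have hΔ : V.Δ ≠ 0 := Δ_ne_zero_of_not_dvd V hℓ₁
  haveI := isElliptic_rat V hΔ
  have hm' : Odd (m : ℤ) := by exact_mod_cast Nat.odd_iff.mpr hm
  have h42 := two_nsmul_eq_zero_of_fullTwoTorsionWitness V hT₁ hT₁2 hT₂ hT₂2 hT₃ hT₃2 ℓ₁ hℓ₁ hodd hB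
    l₁ l₂ l₃ hl₁ hl₂ hl₃ hD₁ hD₂ hD₃
  have htors : ∀ x : (V.map (Int.castRingHom ℚ)).toAffine.Point, IsOfFinAddOrder x →
      ((2 : ℤ) ^ 1 * (m : ℤ)) • x = 0 :=
    fun x hx => torsion_zsmul_eq_zero_of_noOrderFour V hte hS ht h42 x hx
  have h2 := twoTorsion_eq_zero_or_eq3 V hT₁ hT₁2 hT₂ hT₂2 hT₃ hT₃2 ℓ₁ hℓ₁ hodd hB
  refine two_le_mordellWeilRank_of_cosetWitness (V.map (Int.castRingHom ℚ)) hm' htors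
    (P₁ := .some _ _ (nonsingular_rat_of_eq V hΔ h₁))
    (P₂ := .some _ _ (nonsingular_rat_of_eq V hΔ h₂))
    (AddMonoidHom.id _) (AddMonoidHom.id _) (AddMonoidHom.id _) ?_ ?_ ?_
  · exact not_mem_twoCoset_one_of_twoTorsion_subset3 h2
      (not_mem_twoCoset_zero_of_ptFree V q₁₀ hq₁₀ h₁ hw₁₀)
      (not_mem_twoCoset_zero_of_shiftFree V q₁₁ hq₁₁ h₁ hT₁ hw₁₁)
      (not_mem_twoCoset_zero_of_shiftFree V q₁₂ hq₁₂ h₁ hT₂ hw₁₂)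
      (not_mem_twoCoset_zero_of_shiftFree V q₁₃ hq₁₃ h₁ hT₃ hw₁₃)
  · exact not_mem_twoCoset_one_of_twoTorsion_subset3 h2
      (not_mem_twoCoset_zero_of_ptFree V q₂₀ hq₂₀ h₂ hw₂₀)
      (not_mem_twoCoset_zero_of_shiftFree V q₂₁ hq₂₁ h₂ hT₁ hw₂₁)
      (not_mem_twoCoset_zero_of_shiftFree V q₂₂ hq₂₂ h₂ hT₂ hw₂₂)
      (not_mem_twoCoset_zero_of_shiftFree V q₂₃ hq₂₃ h₂ hT₃ hw₂₃)
  · exact not_mem_twoCoset_one_of_twoTorsion_subset3 h2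
      (not_mem_twoCoset_zero_of_sumFree V q₃₀ hq₃₀ h₁ h₂ hw₃₀)
      (not_mem_twoCoset_zero_of_sumShiftFree V q₃₁ hq₃₁ h₁ h₂ hT₁ hw₃₁)
      (not_mem_twoCoset_zero_of_sumShiftFree V q₃₂ hq₃₂ h₁ h₂ hT₂ hw₃₂)
      (not_mem_twoCoset_zero_of_sumShiftFree V q₃₃ hq₃₃ h₁ h₂ hT₃ hw₃₃)

end Assembly

end Summit.BirchSwinnertonDyer.BirchSwinnertonDyer.Rank2Observatory
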